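import Literature.NumberTheory.EllipticCurves.ZpExtensionEisensteinDVRSettingH5cProofs
import Literature.NumberTheory.EllipticCurves.ZpExtensionEisensteinDVRSettingERedProofs
import Literature.NumberTheory.EllipticCurves.WeilConjugatePairingTowerProofs
import HarnessLib

/-!
# The H.4 data `D` of the curve's Eisenstein setting, INSTANTIATED: the Weil–`τ` forms, with `e_red`, H.5(c) and the
# anticyclotomic exponent condition discharged (proofs file)

Topic `NumberTheory/EllipticCurves` (cell `pub/bsd-print-x9`; assembles `WeilConjugatePairingTowerProofs` (the `E`-level
family), D1's `ZpExtensionEisensteinDVRSettingERedProofs` (`e_red`) and `ZpExtensionEisensteinDVRSettingH5cProofs` (H.5(c))).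
THEOREMS ONLY; no definition, no named fact, no instance, no notation, no `sorry`.

Howard, §1.3 H.4/H.5 and Rem. 1.3.2 [arXiv:1202.6340 p. 7, L69–101]: for the Tate module of an elliptic curve over `ℚ`
the pairing `(s, t) = e(s, t^τ)` (Weil pairing, `τ` complex conjugation) supplies H.4's datum, and H.5(c) holds for it.
For the curve's Eisenstein setting (`WeierstrassCurve.eisensteinDVRSetting`, tower `E_K[p^{k+1}] ⊗ A_{m,k+1}(ψ_κ)`):

* `DiscreteGaloisModule.mu_apply_eq_val_nsmul` / `map_mu_eq_cyclotomicCharacterModPow_mul` — `Γ_K` acts on `μ_{p^j}`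
  through `χ̄_j`, so every additive `log` is `χ̄`-equivariant;
* `absGaloisRestrict_conjGalCMH_of_absGaloisTransport` — for a lift `τ = e c₀ e⁻¹` of `σ ∈ Aut(K/ℚ)`,
  `res(τ⁻¹ g τ) = c₀⁻¹ · res g · c₀` in `Γ_ℚ`;
* `ZpExtension.toAdd_conjGalCMH_eq_neg` — hence an ANTICYCLOTOMIC `κ` (`ZpExtension.IsAnticyclotomic`) over a totally
  complex `K` satisfies `κ(τ⁻¹ g τ) = κ(g)⁻¹` for `τ` a transported complex conjugation; so the exponent condition `hκ` of
  `ZpExtension.eisensteinDualityDatum` holds (`twistExponent_add_twistExponent_conj_dvd`);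
* **`WeierstrassCurve.exists_eisensteinDualityData`** — for `κ` anticyclotomic, `K` totally complex and `cd.τ` a transported
  complex conjugation: THERE IS a family `D k : DualityDatum p cd (T^{(k)}) A_{m,k+1}` whose pairings are the Eisenstein
  forms of the Weil–`τ` forms `ẽ_{k+1} = conjPairing (e (k+1)) τ_* (log (k+1))` of `exists_conjPairing_tower`, TOGETHER
  WITH the fields `SatisfiesH.e_red` and `SatisfiesH.h5c` of D1's `eisensteinDVRSettingTame_satisfiesH_of` for this `D`
  (verbatim their hypothesis types, any `fs`), and the raw facts on `(e, log)` that the H.4 local clause consumes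
  (`e_j(a,a) = 0`, `Γ_K`-equivariance, the `τ`-sign, `τ_*` involutive, `log_j` bijective and `χ̄`-equivariant).
  ⇒ of the `D`-dependent inputs of `St.SatisfiesH` only `h4` (`IsSelfOrthogonal`) remains.

BSD is not proved by any of this.

References: [Howard2004HeegnerKolyvagin] §1.3 H.4, H.5(c), Rem. 1.3.2 (arXiv p. 7, L69–101), §1.6 (p. 11, L33–38), §2.2;
[Greenberg1999LNM] §1 (anticyclotomic: `κ(cgc) = κ(g)⁻¹`); [SilvermanAEC2009] III.8.1.
-/

set_option autoImplicit false

noncomputable section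

open Function NumberField IsDedekindDomain Field
open scoped NumberField ContRepresentation TensorProduct Classical

namespace Literature.NumberTheory.EllipticCurves

open Literature.NumberTheory.GaloisRepresentations

/-! ## §1 `res(τ⁻¹ g τ) = c₀⁻¹ · res g · c₀` and the anticyclotomic sign -/

/-- For a lift `τ` of `σ ∈ Aut(K/ℚ)` which is the transport `e γ e⁻¹` of `γ ∈ Γ_ℚ`: the restriction to `ℚ̄` of
`τ⁻¹ g τ ∈ Γ_K` is `γ⁻¹ · res g · γ`. [cite: Greenberg1999LNM, §1 (the action of complex conjugation on Γ = Gal(K_∞/K))] -/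
theorem absGaloisRestrict_conjGalCMH_of_absGaloisTransport {K : Type} [Field K] [NumberField K] {σ : K ≃ₐ[ℚ] K}
    {τ : AlgebraicClosure K ≃+* AlgebraicClosure K} (hτ : IsLiftOfAut σ τ) (γ : absoluteGaloisGroup ℚ)
    (hγ : ∀ x, τ x = absGaloisTransport (K := ℚ) (L := K) γ x) (g : absoluteGaloisGroup K) :
    absGaloisRestrict ℚ K (hτ.conjGalCMH g) = γ⁻¹ * absGaloisRestrict ℚ K g * γ := by
  apply (absGaloisTransport (K := ℚ) (L := K)).injective
  ext y
  have hsymm : ∀ w, τ.symm w = (absGaloisTransport (K := ℚ) (L := K) γ).symm w := fun w ↦ by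
    apply (absGaloisTransport (K := ℚ) (L := K) γ).injective
    rw [AlgEquiv.apply_symm_apply, ← hγ, RingEquiv.apply_symm_apply]
  rw [absGaloisTransport_absGaloisRestrict, map_mul, map_mul, map_inv, AlgEquiv.mul_apply, AlgEquiv.mul_apply,
    absGaloisTransport_absGaloisRestrict, AlgEquiv.aut_inv, ← hγ, ← hsymm, absoluteGaloisGroup.smul_def,
    absoluteGaloisGroup.smul_def]
  rfl

/-- **An anticyclotomic `κ` changes sign under conjugation by a complex conjugation**: for `K` totally complex,
`κ : Γ_K ↠ ℤ_p` anticyclotomic (`ZpExtension.IsAnticyclotomic`) and `τ` a lift of `σ ∈ Aut(K/ℚ)` which is the transport of a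
complex conjugation `c₀ ∈ Γ_ℚ`, `κ(τ⁻¹ g τ) = −κ(g)` (additively). [cite: Greenberg1999LNM, §1 (anticyclotomic ℤ_p-extensions)] -/
theorem ZpExtension.toAdd_conjGalCMH_eq_neg {K : Type} [Field K] [NumberField K] {p : ℕ} [Fact p.Prime]
    (κ : ZpExtension K p) (hκ : κ.IsAnticyclotomic) (himag : ∀ w : NumberField.InfinitePlace K, w.IsComplex)
    {σ : K ≃ₐ[ℚ] K} {τ : AlgebraicClosure K ≃+* AlgebraicClosure K} (hτ : IsLiftOfAut σ τ)
    {c₀ : absoluteGaloisGroup ℚ} (hc₀ : IsComplexConjugation (Rat.castHom ℝ) c₀)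
    (hγ : ∀ x, τ x = absGaloisTransport (K := ℚ) (L := K) c₀ x) (g : absoluteGaloisGroup K) :
    (κ (hτ.conjGalCMH g)).toAdd = -(κ g).toAdd := by
  have hinv : c₀⁻¹ = c₀ := inv_eq_of_mul_eq_one_right (by rw [← pow_two, hc₀.sq_eq_one])
  have hres : absGaloisRestrict ℚ K (hτ.conjGalCMH g) = c₀⁻¹ * absGaloisRestrict ℚ K g * c₀⁻¹⁻¹ := by
    rw [inv_inv]; exact absGaloisRestrict_conjGalCMH_of_absGaloisTransport hτ c₀ hγ g
  have hρ : c₀⁻¹ ∉ Set.range (absGaloisRestrict ℚ K) := by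
    rw [hinv]; exact hc₀.not_mem_range_absGaloisRestrict himag
  rw [hκ g (hτ.conjGalCMH g) c₀⁻¹ hρ hres, toAdd_inv]

end Literature.NumberTheory.EllipticCurves

namespace Literature.NumberTheory.GaloisRepresentations

open DiscreteGaloisModule

/-- **`Γ_K` acts on `μ_{p^j}(K̄)` through the mod-`p^j` cyclotomic character**: `g · ξ = χ̄_j(g).val • ξ`
(`σ ζ = ζ^{χ̄(σ)}`, the defining property `GaloisRep.cyclotomicCharacter_spec`). [cite: SerreGaloisCohomology1997, Ch. II §1.2] -/
theorem DiscreteGaloisModule.mu_apply_eq_val_nsmul (K : Type*) [Field K] (p : ℕ) [Fact p.Prime] [NeZero (p : K)]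
    (j : ℕ) (g : absoluteGaloisGroup K) (ξ : MuCarrier K (p ^ j)) :
    mu K (p ^ j) g ξ = (cyclotomicCharacterModPow K p j g).val • ξ := by
  apply muVal_injective K (p ^ j)
  apply Units.ext
  have ht : ((muVal K (p ^ j) ξ : (AlgebraicClosure K)ˣ) : AlgebraicClosure K) ^ p ^ j = 1 := by
    rw [← Units.val_pow_eq_pow_val, muVal_pow_eq_one, Units.val_one]
  rw [muVal_apply, Units.coe_smul, muVal_nsmul, Units.val_pow_eq_pow_val,
    GaloisRep.cyclotomicCharacter_spec K p g _ ht]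
  rfl

/-- Consequently EVERY additive `log : μ_{p^j}(K̄) → ℤ/p^j` satisfies `log(g · ξ) = χ̄_j(g) · log ξ` (no normalisation of
`log` needed; cf. the tree's `muLog_equivariant_of_spec`). [cite: SerreGaloisCohomology1997, Ch. II §1.2] -/
theorem DiscreteGaloisModule.map_mu_eq_cyclotomicCharacterModPow_mul (K : Type*) [Field K] (p : ℕ) [Fact p.Prime]
    [NeZero (p : K)] (j : ℕ) (log : MuCarrier K (p ^ j) →+ ZMod (p ^ j)) (g : absoluteGaloisGroup K)
    (ξ : MuCarrier K (p ^ j)) :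
    log (mu K (p ^ j) g ξ) = cyclotomicCharacterModPow K p j g * log ξ := by
  rw [mu_apply_eq_val_nsmul, map_nsmul, nsmul_eq_mul, ZMod.natCast_zmod_val]

end Literature.NumberTheory.GaloisRepresentations

namespace WeierstrassCurve

open Literature.NumberTheory.EllipticCurves Literature.NumberTheory.GaloisRepresentations
open Literature.NumberTheory.GaloisRepresentations.DiscreteGaloisModule
open Literature.NumberTheory.GaloisCohomology.Howard2004
open Literature.NumberTheory.EllipticCurves.ZpExtension (EisensteinLevel eisensteinLevel)

variable {K : Type} [Field K] [NumberField K] (W : WeierstrassCurve ℚ) [W.IsElliptic] {p : ℕ} [hp : Fact p.Prime]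
  (κ : ZpExtension K p) {m : ℕ} (hm : 1 ≤ m)
  (S : Finset (HeightOneSpectrum (𝓞 K)))
  (hpS : ∀ v : HeightOneSpectrum (𝓞 K), ((p : ℕ) : 𝓞 K) ∈ v.asIdeal → v ∈ S)
  (hbad : ∀ v : HeightOneSpectrum (𝓞 K), v ∉ S → ((p : ℕ) : 𝓞 K) ∉ v.asIdeal → (W.baseChange K).HasGoodReductionAt v)
  (L : Set (HeightOneSpectrum (𝓞 K)))
  (hL : letI := IwasawaAlgebra.isLocalRing_quotient_X_pow_add_C p hm
    L ⊆ (W.eisensteinTower κ hm).degreeTwoPrimes p)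
  (hLS : ∀ v ∈ L, v ∉ S)
  (jbar : AlgebraicClosure K →+* ℂ) (cd : ConjugationDatum K)

/-! ## §2 The exponent condition `hκ` of `eisensteinDualityDatum` for an anticyclotomic `κ` -/

omit [W.IsElliptic] in
/-- **The `hκ` input of `ZpExtension.eisensteinDualityDatum`**: for `κ` anticyclotomic, `K` totally complex and `cd.τ` a
transported complex conjugation, the twist exponents of `κ` at `g` and `τ⁻¹ g τ` are opposite modulo `p^J` at every level.
[cite: Howard2004HeegnerKolyvagin, §2.2 (the anticyclotomic character ψ)] [cite: Greenberg1999LNM, §1] -/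
theorem eisensteinDualityDatum_hκ_of_isAnticyclotomic (hκ : κ.IsAnticyclotomic)
    (himag : ∀ w : NumberField.InfinitePlace K, w.IsComplex) {c₀ : absoluteGaloisGroup ℚ}
    (hc₀ : IsComplexConjugation (Rat.castHom ℝ) c₀) (hτ : ∀ x, cd.τ x = absGaloisTransport (K := ℚ) (L := K) c₀ x)
    (k : ℕ) (g : absoluteGaloisGroup K) :
    p ^ eisensteinLevel (p := p) hm k ∣ κ.twistExponent (eisensteinLevel (p := p) hm k) g +
      κ.twistExponent (eisensteinLevel (p := p) hm k) (cd.conj g) :=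
  ZpExtension.twistExponent_add_twistExponent_conj_dvd κ cd.conj
    (fun g ↦ ZpExtension.toAdd_conjGalCMH_eq_neg κ hκ himag cd.isLift hc₀ hτ g) _ g

/-! ## §3 The instantiated H.4 data with `e_red` and H.5(c) -/

set_option synthInstance.maxHeartbeats 80000 in
set_option maxHeartbeats 800000 in
/-- **The H.4 data of the Eisenstein setting, instantiated from the Weil pairing and `τ`.**  Let `E = W/ℚ` be elliptic, `K` a
totally complex number field, `p` prime, `κ : Γ_K ↠ ℤ_p` anticyclotomic, `cd` a conjugation datum whose `τ` is the transport
of a complex conjugation `c₀ ∈ Γ_ℚ`.  Then there are `D k : DualityDatum p cd (T^{(k)}) A_{m,k+1}` (`T^{(k)} = E_K[p^{k+1}] ⊗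
A_{m,k+1}(ψ_κ)`), a bi-additive Weil family `e_j : E_K[p^j] →+ E_K[p^j] →+ μ_{p^j}(K̄)` and a compatible discrete logarithm
`log_j` such that: (1) `(D k).e = eisensteinDualityForm hm (k+1) (conjPairing (e (k+1)) τ_* (log (k+1)))` — Howard's
`e_𝔮(t₁ ⊗ α₁, t₂ ⊗ α₂) = ι(log e(t₁, τ t₂)) α₁ α₂`; (2) the field `SatisfiesH.e_red` for `D` (`reduce (e_{k+1}(x,y)) =
e_k(red x, red y)`); (3) the field `SatisfiesH.h5c` for `D` at every level, for the setting with any finite–singular slots `fs`;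
(4) `e_j(a, a) = 0`; (5) `e_j(ga, gb) = g · e_j(a, b)`; (6) `e_j(τ_* a, τ_* b) = −e_j(a, b)`; (7) `τ_* τ_* = id`;
(8) `log_j` bijective; (9) `log_j(g ξ) = χ̄_j(g) log_j ξ`.  Of the `D`-dependent hypotheses of
`eisensteinDVRSettingTame_satisfiesH_of` only `h4` remains.
[cite: Howard2004HeegnerKolyvagin, §1.3 H.4, H.5(c), Rem. 1.3.2 (arXiv p. 7, L69–101) and §1.6 (arXiv p. 11, L33–38)]
[cite: SilvermanAEC2009, Prop. III.8.1] -/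
theorem exists_eisensteinDualityData (hκ : κ.IsAnticyclotomic) (himag : ∀ w : NumberField.InfinitePlace K, w.IsComplex)
    {c₀ : absoluteGaloisGroup ℚ} (hc₀ : IsComplexConjugation (Rat.castHom ℝ) c₀)
    (hτ : ∀ x, cd.τ x = absGaloisTransport (K := ℚ) (L := K) c₀ x) :
    letI := IwasawaAlgebra.isDomain_quotient_X_pow_add_C p hm
    letI := IwasawaAlgebra.isDiscreteValuationRing_quotient_X_pow_add_C p hm
    haveI := IwasawaAlgebra.EisensteinCoeff.isLocalRing_succ p hm
    letI := IwasawaAlgebra.EisensteinCoeff.algebraOfSpecSucc p m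
    haveI := W.isScalarTower_algebraOfSpecSucc (K := K) (p := p) (m := m)
    letI := W.residueModuleSucc (K := K) (p := p) hm
    ∃ (D : ∀ k, DualityDatum p cd ((W.eisensteinTower κ hm).ρ k) (IwasawaAlgebra.EisensteinCoeff p m (k + 1)))
      (e : ∀ j : ℕ, geomTorsion (W.baseChange K) ((p : ℤ) ^ j) →+ geomTorsion (W.baseChange K) ((p : ℤ) ^ j) →+
        MuCarrier K (p ^ j))
      (log : ∀ j : ℕ, MuCarrier K (p ^ j) →+ ZMod (p ^ j)),
      (∀ k, (D k).e = ZpExtension.eisensteinDualityForm hm (k + 1)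
        (conjPairing (e (k + 1)) (cd.isLift.torsionMap W _) (log (k + 1)))) ∧
      (∀ k (x y : EisensteinLevel p m (fun j ↦ geomTorsion (W.baseChange K) ((p : ℤ) ^ j)) (k + 1 + 1)),
        IwasawaAlgebra.EisensteinCoeff.reduce p m (Nat.le_succ (k + 1)) ((D (k + 1)).e x y) =
          (D k).e ((W.eisensteinTower κ hm).red k x) ((W.eisensteinTower κ hm).red k y)) ∧
      (∀ (fs : ∀ (k : ℕ) (n : Finset (HeightOneSpectrum (𝓞 K))) (v : HeightOneSpectrum (𝓞 K)),
          galoisCohomology ((W.eisensteinLevelQuot κ hm k n).toLocal (Sum.inr v)) 1 →+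
            SingularQuotient (GaloisRep.toLocal v (W.eisensteinLevelQuot κ hm k n)) ⊗[ℤ] Gell v) (k : ℕ),
        H5c (D k) ((W.eisensteinDVRSetting κ hm S hpS hbad L hL hLS jbar cd D fs).πbar k)
          (W.residualTauGeomTorsion (p := p) cd hm (k := k + 1) k.succ_pos)) ∧
      (∀ j a, e j a a = 0) ∧
      (∀ j (g : absoluteGaloisGroup K) a b, e j (g • a) (g • b) = mu K (p ^ j) g (e j a b)) ∧
      (∀ j a b, e j (cd.isLift.torsionMap W _ a) (cd.isLift.torsionMap W _ b) = -e j a b) ∧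
      (∀ j (a : geomTorsion (W.baseChange K) ((p : ℤ) ^ j)),
        cd.isLift.torsionMap W _ (cd.isLift.torsionMap W _ a) = a) ∧
      (∀ j, Function.Bijective (log j)) ∧
      (∀ j (g : absoluteGaloisGroup K) ξ, log j (mu K (p ^ j) g ξ) = cyclotomicCharacterModPow K p j g * log j ξ) := by
  letI := IwasawaAlgebra.isDomain_quotient_X_pow_add_C p hm
  letI := IwasawaAlgebra.isDiscreteValuationRing_quotient_X_pow_add_C p hm
  haveI := IwasawaAlgebra.EisensteinCoeff.isLocalRing_succ p hm
  letI := IwasawaAlgebra.EisensteinCoeff.algebraOfSpecSucc p m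
  haveI := W.isScalarTower_algebraOfSpecSucc (K := K) (p := p) (m := m)
  letI := W.residueModuleSucc (K := K) (p := p) hm
  obtain ⟨e, log, hW1, hW3, hW4, hθθ, hL1, hsymm, hequiv, hnd, hex, hcompat, hsign⟩ :=
    W.exists_conjPairing_tower p cd.isLift hc₀ hτ
  -- the `E`-level forms `ẽ_j = conjPairing (e j) τ_* (log j)` and the data `D k`
  let eb : ∀ j, geomTorsion (W.baseChange K) ((p : ℤ) ^ j) →+ geomTorsion (W.baseChange K) ((p : ℤ) ^ j) →+ ZMod (p ^ j) :=
    fun j ↦ conjPairing (e j) (cd.isLift.torsionMap W _) (log j)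
  have hκ' := eisensteinDualityDatum_hκ_of_isAnticyclotomic κ hm cd hκ himag hc₀ hτ
  let D : ∀ k, DualityDatum p cd ((W.eisensteinTower κ hm).ρ k) (IwasawaAlgebra.EisensteinCoeff p m (k + 1)) := fun k ↦
    ZpExtension.eisensteinDualityDatum hm (k + 1) cd κ ((W.baseChange K).torsionGaloisModule ((p : ℤ) ^ (k + 1)))
      (eb (k + 1)) (hsymm (k + 1)) (hequiv (k + 1)) (hnd (k + 1)) (hex (k + 1)) (hκ' (k + 1))
  have hDe : ∀ k, (D k).e = ZpExtension.eisensteinDualityForm hm (k + 1) (eb (k + 1)) := fun k ↦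
    ZpExtension.eisensteinDualityDatum_e hm (k + 1) cd κ _ (eb (k + 1)) (hsymm (k + 1)) (hequiv (k + 1)) (hnd (k + 1))
      (hex (k + 1)) (hκ' (k + 1))
  refine ⟨D, e, log, hDe, ?_, ?_, hW1, hW3, hW4, hθθ, hL1, fun j g ξ ↦ ?_⟩
  · -- `e_red` (D1's `eisensteinDVRSetting_e_red_of`, fed with the level compatibility of the Weil–τ forms)
    exact W.eisensteinDVRSetting_e_red_of κ hm cd eb hsymm hequiv hnd hex hκ' (fun k a b ↦ hcompat (k + 1) a b)
  · -- H.5(c) (`eisensteinDVRSetting_h5c_of`, fed with the `τ`-sign of the Weil–τ forms)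
    intro fs k
    exact W.eisensteinDVRSetting_h5c_of κ hm S hpS hbad L hL hLS jbar cd D fs eb hDe hsign k
  · -- `χ̄`-equivariance of ANY additive `log_j`
    haveI : NeZero (p : K) := ⟨by exact_mod_cast hp.out.ne_zero⟩
    exact DiscreteGaloisModule.map_mu_eq_cyclotomicCharacterModPow_mul K p j (log j) g ξ

end WeierstrassCurve

end
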